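/-
# `Balaban1983to89.B5SupFactor129AdjTorus` — Bałaban CMP 95 (1984), Proposition 1.2, step S1 AS PRINTED on the torus of record:
# THE FACTOR ESTIMATES OF THE ADJOINT WALK (p. 39 «a representation of G adjoint to (1.123), with the operators K(h) acting
# on the right») for the entries `|G∇*J|` (1.110) and `‖ζG∇*J‖_α` (1.111): monopole and dipole sources on the `ℓ¹` carrier

statement-level skeleton of published theorems with citation tags; proofs where landed; nothing here is a claim
about the Yang–Mills mass gap

CITATION HEADER (lean-in-tree rule).  Cell `lit-balaban`, unit `lit-balaban-p38` (Phase-2 proof seat p38 gen 8), HOME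
`run/shared/lean/pub/lit-balaban/` (SKELETON rows B5.Eq1.125, B5.Eq1.129, B5.Eq1.130, B5.Prop1.2; owner r02).  B5 = T. Bałaban,
*Propagators and renormalization transformations for lattice gauge theories. I*, Commun. Math. Phys. **95** (1984) 17–40
[`Balaban1984PropagatorsI`], held as `paper:balaban1984-cmp95-propagators-rt-i` (journal page = PDF page + 16).  FILE C′ of the
p38-gen-8 half (DomCert side) of the sup/Hölder (S1) torus instantiation of `B5SupWalkS1.SupRealisation` (B5-CLOSURE §5 item 2);
FILES A/B/C = `B5SupCarrierTorus` / `B5SupHolderTorus` / `B5SupFactor125Torus`.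

WHAT IS PRINTED.  p. 39 [PDF 23 L7–9], verbatim: «The proofs of the other inequalities are exactly the same, but in the estimates
of G∇*J we have to take a representation of G adjoint to (1.123), with the operators K(h) acting on the right.»  p. 37–38:
«The factors with G are estimated by using (1.115). For the first factor we have ‖ζ∇h_zGh_zA‖_α ≤ O(1)(‖ζ‖_α + |ζ|)|h_zA|.
(1.125)» … «The last factor in each term is estimated by using (1.115), (1.116) … (1.129)».  p. 33, Prop. 1.1: «The operator G is
a symmetric operator on L²(T_η)».

WHY THE ADJOINT WALK, AND HOW IT IS READ (as announced in `B5SupWalkS1`, Honest scope (2), and `B5SupCarrierTorus` §2).  For the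
entries `|(G∇*J)(x)| ≤ O(1)e^{−δ₀|y−y′|}|J|` of (1.110) and `‖ζG∇*J‖_α ≤ O(1)e^{−δ₀|y−y′|}(‖ζ‖_α + |ζ|)|J|` of (1.111) the direct
last factor (1.129) costs `‖J‖_ε`, which their right sides do not afford; in the adjoint representation the source end carries
`∇*J` through a `G`-factor read by duality.  Concretely `(G∇*J)(b) = ⟨∇(G e_b), J⟩` and `|x−x′|^{−α}[(G∇*J)(b′) − (G∇*J)(b)] =
|x−x′|^{−α}⟨∇(G(e_{b′} − e_b)), J⟩` (`G` symmetric, `∇*` the adjoint of `∇`): the walk runs from the MONOPOLE `e_b` / DIPOLE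
`e_{b′} − e_b` (on the `ℓ¹` carrier `V1`) at the `y`-end to the output functional `A ↦ ⟨∇A, J⟩` at the `y′`-end.

WHAT THIS MODULE PROVES (kernel-checked, zero sorry) — real setting of record, `G = GR`, multipliers `h_z = gz z`, `M₀ ≥ 1`, under
`hG : B5.Global115_117 (latticeSettingP12R n M a k) (gP12R M n a k) C Cα Cε Cαε`, `0 < C`:
§1 THE PAIRINGS: `pair T A = Σ_{ν,b} (∇_νA)(b)T_ν(b) = Σ_b A(b)(∇*T)(b)` (`pair_eq_sum_divTR`), the adjoint identities
   `pair T (G v) = Σ_b v(b)(G∇*T)(b)`, `pair T (h_zGh_z v) = Σ_b v(b)(h_zGh_z∇*T)(b)` (G symmetric, Prop. 1.1), so that the monopole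
   reads `(G∇*T)(b₀)` and the dipole reads the Hölder quotient of `G∇*T`;
§2 THE FIRST FACTOR (1.125) FOR THE OUTPUT FUNCTIONAL `A ↦ ⟨∇A, T⟩` ON THE `ℓ¹` CARRIER: `|pair T (h_zGB)| ≤ (1 + dLw)·C·‖B‖₁·|T|`
   and `|pair T (GB)| ≤ C‖B‖₁|T|` (ℓ¹ Leibniz `‖∇(h_zW)‖₁ ≤ ‖∇W‖₁ + d(Lw/M₀)‖W‖₁` + the ℓ¹ reading of (1.115) of FILE A);
§3 THE LAST FACTOR (1.129) FOR THE ADJOINT SOURCES, by Hölder DUALITY from (1.115): monopole `‖G(h_ze_b)‖₁, ‖∇G(h_ze_b)‖₁ ≤ C`;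
   dipole at a pair `0 < |x−x′| ≤ 1`: `‖G(h_z(e_{b′} − e_b))‖₁ ≤ (Lw + d)·C·|x−x′|^α` (from `|∇GB| ≤ C|B|` and the lattice path) and
   `‖∇G(h_z(e_{b′} − e_b))‖₁ ≤ (Lw·C + |C_α(α)|)·|x−x′|^α` (from `‖G∇*T‖_α ≤ C_α|T|`);
§4 THE ONE-FACTOR TERMS (1.130) of the adjoint problems: `|(h_zGh_z∇*T)(b₀)| ≤ (1 + dLw)C|T|` and the Hölder quotient of
   `h_z·G(h_z∇*T)` at a pair `≤ ((Lw + d²Lw)(1 + dLw)·C + |C_α(α)|(1 + Lw))·|T|·|x−x′|^α`.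

HONEST SCOPE / DIVERGENCE.  (1) The paper does not spell the adjoint estimates out («exactly the same»); the duality reading is
ours and is the natural one (every bound used is a member of (1.115) for the SYMMETRIC `G`, p. 33).  (2) Read at one point / one
pair, as consumed by the walk machine; constants ours, explicit, linear in `C`, `C_α(α)`, uniform in `η`, volume, `k`, `M₀ ≥ 1`.
CELL BOOK-KEEPING (lit-balaban): rows B5.Eq1.125 / B5.Eq1.129 / B5.Eq1.130 («adjoint representation, torus instance for G of
record»), B5.Prop1.2 (S1-torus programme, p38 half, file C′) — cells only, NO head change; value = the p. 39 sentence made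
concrete and kernel-checked, NOT summit progress.
-/
import Mathlib
import Literature.MathematicalPhysics.QuantumFieldTheory.Balaban1983to89.B5SupFactor125Torus

open Finset

namespace Literature.MathematicalPhysics.QuantumFieldTheory.Balaban1983to89.B5SupFactor129AdjTorus

open scoped BigOperators Matrix
open WithLp
open Literature.MathematicalPhysics.QuantumFieldTheory.Balaban1983to89
open Literature.MathematicalPhysics.QuantumFieldTheory.Balaban1983to89.B5Prop11Plancherel (Tor fine unitVec)
open Literature.MathematicalPhysics.QuantumFieldTheory.Balaban1983to89.B5Prop12FieldsLattice (distU cubeT cubeB holderV holderT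
  cutSupL distU_nonneg)
open Literature.MathematicalPhysics.QuantumFieldTheory.Balaban1983to89.B5RealFields (GR fdiffR gradR divTR cplx)
open Literature.MathematicalPhysics.QuantumFieldTheory.Balaban1983to89.B5SettingP12Real (LocR VecR latticeSettingP12R gP12R)
open Literature.MathematicalPhysics.QuantumFieldTheory.Balaban1983to89.B5WalkTorusGeom (TorR ucPt Cen)
open Literature.MathematicalPhysics.QuantumFieldTheory.Balaban1983to89.B5WalkCarrierTorus (Bnd)
open Literature.MathematicalPhysics.QuantumFieldTheory.Balaban1983to89.B5CombesThomasLattice (nb)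
open Literature.MathematicalPhysics.QuantumFieldTheory.Balaban1983to89.B5WalkH128Torus (gz abs_gz_le_one abs_gz_sub_le
  fdiffR_mulVec_apply)
open Literature.MathematicalPhysics.QuantumFieldTheory.Balaban1983to89.B5WalkLeibnizTorus (gradR_mul_eq)
open Literature.MathematicalPhysics.QuantumFieldTheory.Balaban1983to89.B5CoverP12Lattice (Lw Lw_nonneg distU_comm)
open Literature.MathematicalPhysics.QuantumFieldTheory.Balaban1983to89.LatticeNorms (supNorm holderSeminormB5)
open Literature.MathematicalPhysics.QuantumFieldTheory.Balaban1983to89.B5SupCarrierTorus (Gs Gs_apply Dgs Dgs_apply V1 Vg1 eS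
  G1 H1 Dg1 ofLp_G1 H1_apply Dg1_apply norm_V1 norm_Vg1 norm_G1_le_of_global norm_Dg1_G1_le_of_global sum_abs_mulVec_le_of_transpose
  norm_sign_le_one divTR_apply)
open Literature.MathematicalPhysics.QuantumFieldTheory.Balaban1983to89.B5SupHolderTorus (abs_le_norm abs_le_norm_ten
  norm_le_of_forall_abs_le abs_fdiffR_le norm_gz_mul_le abs_dgz_le dgz norm_dgz_le le_rpow_self_of_le_one abs_sub_le_holderV_mul
  abs_mul_sub_mul_le)
open Literature.MathematicalPhysics.QuantumFieldTheory.Balaban1983to89.B5SupFactor125Torus (norm_G_le norm_gradR_G_le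
  holderV_G_divTR_le_of_global pair_grad_le norm_G_gz_divTR_le norm_gradR_G_gz_divTR_le gz_divTR_eq)
open Literature.MathematicalPhysics.QuantumFieldTheory.Balaban1983to89.B5WalkCertsTorus (Lw_div_le gradR_add)

noncomputable section

variable {d : ℕ}

/-! ## §1 The pairing `⟨∇A, T⟩` and the adjoint identities -/

section Pairing

variable {n : ℕ} [NeZero n] {M : Fin d → ℕ} [hM : ∀ μ, NeZero (M μ)] {a : ℝ} {M₀ : ℕ}

/-- **the output functional of the adjoint problems as a number**: `pair T A = ⟨∇A, T⟩ = Σ_{ν,b} (∇_νA)(b)·T_ν(b)`.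
[cite: Balaban1984PropagatorsI, p.39 L7–9, (1.110) p.35 (G∇*J)] -/
def pair (n : ℕ) [NeZero n] (M : Fin d → ℕ) [∀ μ, NeZero (M μ)] (T : Fin d → VecR n M) (A : VecR n M) : ℝ :=
  ∑ ν, ∑ b, gradR n M A ν b * T ν b

/-- `⟨∇A, T⟩ = ⟨A, ∇*T⟩` (the divergence is the adjoint of the gradient). [cite: Balaban1984PropagatorsI, (1.21) p.21 (∂* the adjoint), p.39] -/
theorem pair_eq_sum_divTR (T : Fin d → VecR n M) (A : VecR n M) : pair n M T A = ∑ b, A b * divTR n M T b := by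
  have h1 : ∀ ν, ∑ b, gradR n M A ν b * T ν b = ∑ b, A b * ((fdiffR n M ν)ᵀ *ᵥ T ν) b := fun ν => by
    have h : (fdiffR n M ν *ᵥ A) ⬝ᵥ T ν = A ⬝ᵥ ((fdiffR n M ν)ᵀ *ᵥ T ν) := by
      rw [Matrix.dotProduct_mulVec, Matrix.vecMul_transpose]
    simpa only [dotProduct, gradR] using h
  unfold pair
  simp_rw [h1]
  rw [Finset.sum_comm]
  refine Finset.sum_congr rfl fun b _ => ?_
  rw [← Finset.mul_sum]
  congr 1
  unfold divTR
  exact (Finset.sum_apply b Finset.univ (fun ν => (fdiffR n M ν)ᵀ *ᵥ T ν)).symm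

/-- `pair` is linear in `A`: additivity. [cite: Balaban1984PropagatorsI, p.39 L7–9] -/
theorem pair_add (T : Fin d → VecR n M) (A B : VecR n M) : pair n M T (A + B) = pair n M T A + pair n M T B := by
  simp only [pair_eq_sum_divTR, Pi.add_apply, add_mul, Finset.sum_add_distrib]

/-- `pair` is linear in `A`: homogeneity. [cite: Balaban1984PropagatorsI, p.39 L7–9] -/
theorem pair_smul (T : Fin d → VecR n M) (c : ℝ) (A : VecR n M) : pair n M T (c • A) = c * pair n M T A := by
  simp only [pair_eq_sum_divTR, Pi.smul_apply, smul_eq_mul, mul_assoc, Finset.mul_sum]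

/-- symmetry of `G` in a finite sum: `Σ_b (Gv)(b)w(b) = Σ_b v(b)(Gw)(b)`. [cite: Balaban1984PropagatorsI, Prop. 1.1 p.33 («G is a symmetric operator»)] -/
theorem sum_G_mul_eq (hn : 1 ≤ n) (ha : 0 < a) (v w : VecR n M) :
    ∑ b, (GR n M a *ᵥ v) b * w b = ∑ b, v b * (GR n M a *ᵥ w) b := by
  have h := B5RealFields.GR_mulVec_dotProduct n hn M a ha v w
  simpa only [dotProduct] using h

/-- symmetry of a multiplier in a finite sum. [cite: Balaban1984PropagatorsI, (1.118) p.36] -/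
theorem sum_gz_mul_eq (z : Cen M M₀) (v w : VecR n M) :
    ∑ b, (gz n M M₀ z b * v b) * w b = ∑ b, v b * (gz n M M₀ z b * w b) :=
  Finset.sum_congr rfl fun b _ => by ring

/-- **THE ADJOINT IDENTITY**: `⟨∇(Gv), T⟩ = Σ_b v(b)·(G∇*T)(b)` — the direct walk of `Gv` read by `⟨∇·, T⟩` IS `G∇*T` paired
with `v` (p. 39 «a representation of G adjoint to (1.123)»). [cite: Balaban1984PropagatorsI, p.39 L7–9, Prop. 1.1 p.33] -/
theorem pair_G_eq (hn : 1 ≤ n) (ha : 0 < a) (T : Fin d → VecR n M) (v : VecR n M) :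
    pair n M T (GR n M a *ᵥ v) = ∑ b, v b * (GR n M a *ᵥ divTR n M T) b := by
  rw [pair_eq_sum_divTR, sum_G_mul_eq hn ha]

/-- **THE ADJOINT IDENTITY FOR THE ONE-FACTOR TERM**: `⟨∇(h_zGh_zv), T⟩ = Σ_b v(b)·(h_zGh_z∇*T)(b)`.
[cite: Balaban1984PropagatorsI, p.39 L7–9, (1.130) p.38] -/
theorem pair_gz_G_gz_eq (hn : 1 ≤ n) (ha : 0 < a) (z : Cen M M₀) (T : Fin d → VecR n M) (v : VecR n M) :
    pair n M T (fun b => gz n M M₀ z b * (GR n M a *ᵥ fun b' => gz n M M₀ z b' * v b') b)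
      = ∑ b, v b * (gz n M M₀ z b * (GR n M a *ᵥ fun b' => gz n M M₀ z b' * divTR n M T b') b) := by
  rw [pair_eq_sum_divTR]
  calc ∑ b, gz n M M₀ z b * (GR n M a *ᵥ fun b' => gz n M M₀ z b' * v b') b * divTR n M T b
      = ∑ b, (GR n M a *ᵥ fun b' => gz n M M₀ z b' * v b') b * (gz n M M₀ z b * divTR n M T b) :=
        Finset.sum_congr rfl fun b _ => by ring
    _ = ∑ b, (gz n M M₀ z b * v b) * (GR n M a *ᵥ fun b' => gz n M M₀ z b' * divTR n M T b') b := sum_G_mul_eq hn ha _ _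
    _ = _ := Finset.sum_congr rfl fun b _ => by ring

/-- the monopole `e_{b₀}`. [cite: Balaban1984PropagatorsI, p.39 L7–9] -/
def mono (n : ℕ) (M : Fin d → ℕ) (b₀ : Bnd n M) : VecR n M := Pi.single b₀ 1

/-- the dipole `e_{b′} − e_b`. [cite: Balaban1984PropagatorsI, p.39 L7–9, (1.109) p.35] -/
def dip (n : ℕ) (M : Fin d → ℕ) (b b' : Bnd n M) : VecR n M := Pi.single b' 1 - Pi.single b 1

/-- pairing with the monopole is evaluation: `Σ_b e_{b₀}(b)w(b) = w(b₀)`. [cite: Balaban1984PropagatorsI, p.39 L7–9] -/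
theorem sum_mono_mul (b₀ : Bnd n M) (w : VecR n M) :
    ∑ b, mono n M b₀ b * w b = w b₀ := by
  simp only [mono, Pi.single_apply, ite_mul, one_mul, zero_mul, Finset.sum_ite_eq', Finset.mem_univ, if_true]

/-- pairing with the dipole is a difference: `Σ_b (e_{b′} − e_b)(c)w(c) = w(b′) − w(b)`. [cite: Balaban1984PropagatorsI, p.39 L7–9] -/
theorem sum_dip_mul (b b' : Bnd n M) (w : VecR n M) :
    ∑ c, dip n M b b' c * w c = w b' - w b := by
  simp only [dip, Pi.sub_apply, sub_mul, Finset.sum_sub_distrib, Pi.single_apply, ite_mul, one_mul, zero_mul,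
    Finset.sum_ite_eq', Finset.mem_univ, if_true]

/-- `‖e_{b₀}‖₁ = 1`-type bound: `Σ_b |c·e_{b₀}(b)| ≤ |c|`. [cite: Balaban1984PropagatorsI, p.39 L7–9] -/
theorem sum_abs_smul_mono_le (b₀ : Bnd n M) (c : ℝ) :
    ∑ b, |c * mono n M b₀ b| ≤ |c| := by
  have h : ∀ b, |c * mono n M b₀ b| = if b = b₀ then |c| else 0 := fun b => by
    unfold mono; rw [Pi.single_apply]; split_ifs <;> simp
  simp_rw [h]
  rw [Finset.sum_ite_eq', if_pos (Finset.mem_univ _)]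

end Pairing

/-! ## §2 The first factor (1.125) for the output functional `⟨∇·, T⟩` on the `ℓ¹` carrier -/

section FirstAdj

variable {n : ℕ} [NeZero n] {M : Fin d → ℕ} [hM : ∀ μ, NeZero (M μ)] {a : ℝ} {M₀ : ℕ} (k : ℕ)
  {C : ℝ} {Cα Cε : ℝ → ℝ} {Cαε : ℝ → ℝ → ℝ}

/-- the `ℓ¹` norm of a field: `Σ_b |W(b)|`. [cite: Balaban1984PropagatorsI, p.39 L7–9] -/
def l1 (n : ℕ) [NeZero n] (M : Fin d → ℕ) [∀ μ, NeZero (M μ)] (W : VecR n M) : ℝ := ∑ b, |W b|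

/-- the `ℓ¹` norm of the gradient: `Σ_{ν,b} |(∇_νW)(b)|`. [cite: Balaban1984PropagatorsI, p.39 L7–9, (1.108) p.35] -/
def l1grad (n : ℕ) [NeZero n] (M : Fin d → ℕ) [∀ μ, NeZero (M μ)] (W : VecR n M) : ℝ := ∑ ν, ∑ b, |gradR n M W ν b|

/-- `|⟨∇A, T⟩| ≤ ‖∇A‖₁·|T|`. [cite: Balaban1984PropagatorsI, p.39 L7–9, (1.108) p.35] -/
theorem abs_pair_le (T : Fin d → VecR n M) (A : VecR n M) : |pair n M T A| ≤ l1grad n M A * ‖T‖ := by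
  unfold pair l1grad
  rw [Finset.sum_mul]
  refine (Finset.abs_sum_le_sum_abs _ _).trans (Finset.sum_le_sum fun ν _ => ?_)
  rw [Finset.sum_mul]
  refine (Finset.abs_sum_le_sum_abs _ _).trans (Finset.sum_le_sum fun b _ => ?_)
  rw [abs_mul]
  exact mul_le_mul_of_nonneg_left (abs_le_norm_ten T ν b) (abs_nonneg _)

/-- **ℓ¹ Leibniz**: `‖∇(h_zW)‖₁ ≤ ‖∇W‖₁ + d(Lw/M₀)‖W‖₁`. [cite: Balaban1984PropagatorsI, (1.125) p.38, (1.121) p.37] -/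
theorem l1grad_gz_mul_le (hn : 1 ≤ n) (hM₀ : 1 ≤ M₀) (z : Cen M M₀) (W : VecR n M) :
    l1grad n M (fun b => gz n M M₀ z b * W b) ≤ l1grad n M W + d * (Lw d / M₀) * l1 n M W := by
  unfold l1grad l1
  rw [gradR_mul_eq]
  have hL : 0 ≤ Lw d / M₀ := div_nonneg (Lw_nonneg d) (Nat.cast_nonneg _)
  calc ∑ ν, ∑ b, |((fun ν b => gz n M M₀ z (nb n M ν b) * gradR n M W ν b)
          + fun ν b => (n * (gz n M M₀ z (nb n M ν b) - gz n M M₀ z b)) * W b) ν b|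
      ≤ ∑ ν, ∑ b, (|gradR n M W ν b| + Lw d / M₀ * |W b|) := by
        refine Finset.sum_le_sum fun ν _ => Finset.sum_le_sum fun b _ => ?_
        simp only [Pi.add_apply]
        refine (abs_add_le _ _).trans (add_le_add ?_ ?_)
        · rw [abs_mul]
          have h1 := abs_gz_le_one (n := n) z (nb n M ν b)
          have h0 := abs_nonneg (gradR n M W ν b)
          nlinarith
        · rw [abs_mul]
          exact mul_le_mul_of_nonneg_right (abs_dgz_le hn hM₀ z ν b) (abs_nonneg _)
    _ = ∑ ν, ∑ b, |gradR n M W ν b| + d * (Lw d / M₀) * ∑ b, |W b| := by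
        simp only [Finset.sum_add_distrib, ← Finset.mul_sum, Finset.sum_const, Finset.card_univ, Fintype.card_fin,
          nsmul_eq_mul]
        ring

/-- the `ℓ¹` norms of FILE A՚s carrier are `l1`, `l1grad`. [cite: Balaban1984PropagatorsI, p.39 L7–9] -/
theorem norm_V1_eq_l1 (v : V1 n M) : ‖v‖ = l1 n M (ofLp v) := by
  rw [norm_V1]; rfl

/-- the `ℓ¹` norm of `Dg1 v` is `l1grad (ofLp v)`. [cite: Balaban1984PropagatorsI, p.39 L7–9, (1.108) p.35] -/
theorem norm_Dg1_eq_l1grad (v : V1 n M) : ‖Dg1 n M v‖ = l1grad n M (ofLp v) := by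
  rw [norm_Vg1, l1grad, Fintype.sum_prod_type]
  rfl

/-- **(1.115) on the `ℓ¹` carrier as plain sums**: `‖GB‖₁ ≤ C‖B‖₁`, `‖∇GB‖₁ ≤ C‖B‖₁`. [cite: Balaban1984PropagatorsI, (1.115) p.36, p.39 L7–9] -/
theorem l1_G_le (hn : 1 ≤ n) (ha : 0 < a) (hC : 0 ≤ C)
    (hG : B5.Global115_117 (latticeSettingP12R n M a k) (gP12R M n a k) C Cα Cε Cαε) (B : VecR n M) :
    l1 n M (GR n M a *ᵥ B) ≤ C * l1 n M B ∧ l1grad n M (GR n M a *ᵥ B) ≤ C * l1 n M B := by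
  have h1 := norm_G1_le_of_global k hn ha hC hG (toLp 1 B)
  have h2 := norm_Dg1_G1_le_of_global k hn ha hC hG (toLp 1 B)
  rw [norm_V1_eq_l1, norm_V1_eq_l1, ofLp_G1] at h1
  rw [norm_Dg1_eq_l1grad, norm_V1_eq_l1, ofLp_G1] at h2
  exact ⟨h1, h2⟩

/-- **(1.125) FOR THE ADJOINT OUTPUT FUNCTIONAL**: `|⟨∇(h_zGB), T⟩| ≤ (1 + dLw)·C·‖B‖₁·|T|` (ℓ¹ Leibniz + (1.115) on `ℓ¹`).
[cite: Balaban1984PropagatorsI, (1.125) p.38, (1.115) p.36, p.39 L7–9] -/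
theorem abs_pair_gz_G_le (hn : 1 ≤ n) (ha : 0 < a) (hM₀ : 1 ≤ M₀) (hC : 0 ≤ C)
    (hG : B5.Global115_117 (latticeSettingP12R n M a k) (gP12R M n a k) C Cα Cε Cαε) (z : Cen M M₀)
    (T : Fin d → VecR n M) (B : VecR n M) :
    |pair n M T (fun b => gz n M M₀ z b * (GR n M a *ᵥ B) b)| ≤ (1 + d * Lw d) * C * l1 n M B * ‖T‖ := by
  refine (abs_pair_le T _).trans (mul_le_mul_of_nonneg_right ?_ (norm_nonneg T))
  refine (l1grad_gz_mul_le hn hM₀ z _).trans ?_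
  obtain ⟨h1, h2⟩ := l1_G_le k hn ha hC hG B
  have h3 := Lw_div_le (d := d) hM₀
  have hd : (0 : ℝ) ≤ d := Nat.cast_nonneg d
  have hl1 : 0 ≤ l1 n M B := Finset.sum_nonneg fun _ _ => abs_nonneg _
  have e1 : d * (Lw d / M₀) * l1 n M (GR n M a *ᵥ B) ≤ d * Lw d * (C * l1 n M B) :=
    mul_le_mul (mul_le_mul_of_nonneg_left h3 hd) h1 (Finset.sum_nonneg fun _ _ => abs_nonneg _)
      (mul_nonneg hd (Lw_nonneg d))
  nlinarith

/-- **the remainder clause for the adjoint output functional**: `|⟨∇(GB), T⟩| ≤ C‖B‖₁|T|`. [cite: Balaban1984PropagatorsI, (1.115) p.36, p.39 L7–9] -/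
theorem abs_pair_G_le (hn : 1 ≤ n) (ha : 0 < a) (hC : 0 ≤ C)
    (hG : B5.Global115_117 (latticeSettingP12R n M a k) (gP12R M n a k) C Cα Cε Cαε)
    (T : Fin d → VecR n M) (B : VecR n M) :
    |pair n M T (GR n M a *ᵥ B)| ≤ C * l1 n M B * ‖T‖ :=
  (abs_pair_le T _).trans (mul_le_mul_of_nonneg_right (l1_G_le k hn ha hC hG B).2 (norm_nonneg T))

/-- `0 ≤ ‖W‖₁`. [cite: Balaban1984PropagatorsI, p.39 L7–9] -/
theorem l1_nonneg (W : VecR n M) : 0 ≤ l1 n M W := Finset.sum_nonneg fun _ _ => abs_nonneg _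

/-- `0 ≤ ‖∇W‖₁`. [cite: Balaban1984PropagatorsI, p.39 L7–9] -/
theorem l1grad_nonneg (W : VecR n M) : 0 ≤ l1grad n M W :=
  Finset.sum_nonneg fun _ _ => Finset.sum_nonneg fun _ _ => abs_nonneg _

/-- `‖cW‖₁ = |c|‖W‖₁`. [cite: Balaban1984PropagatorsI, p.39 L7–9] -/
theorem l1_smul (c : ℝ) (W : VecR n M) : l1 n M (c • W) = |c| * l1 n M W := by
  unfold l1
  simp only [Pi.smul_apply, smul_eq_mul, abs_mul, Finset.mul_sum]

/-- `‖∇(cW)‖₁ = |c|‖∇W‖₁`. [cite: Balaban1984PropagatorsI, p.39 L7–9] -/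
theorem l1grad_smul (c : ℝ) (W : VecR n M) : l1grad n M (c • W) = |c| * l1grad n M W := by
  unfold l1grad gradR
  simp only [Matrix.mulVec_smul, Pi.smul_apply, smul_eq_mul, abs_mul, Finset.mul_sum]

/-- `‖U + W‖₁ ≤ ‖U‖₁ + ‖W‖₁`. [cite: Balaban1984PropagatorsI, p.39 L7–9] -/
theorem l1_add_le (U W : VecR n M) : l1 n M (U + W) ≤ l1 n M U + l1 n M W := by
  unfold l1
  rw [← Finset.sum_add_distrib]
  exact Finset.sum_le_sum fun b _ => abs_add_le (U b) (W b)

/-- `‖∇(U + W)‖₁ ≤ ‖∇U‖₁ + ‖∇W‖₁`. [cite: Balaban1984PropagatorsI, p.39 L7–9] -/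
theorem l1grad_add_le (U W : VecR n M) : l1grad n M (U + W) ≤ l1grad n M U + l1grad n M W := by
  unfold l1grad
  rw [gradR_add, ← Finset.sum_add_distrib]
  refine Finset.sum_le_sum fun ν _ => ?_
  rw [← Finset.sum_add_distrib]
  exact Finset.sum_le_sum fun b _ => abs_add_le _ _

/-- linearity of `s ↦ G(h_z s)`: scalars. [cite: Balaban1984PropagatorsI, (1.123) p.37] -/
theorem G_gz_smul (z : Cen M M₀) (c : ℝ) (s : VecR n M) :
    (GR n M a *ᵥ fun b => gz n M M₀ z b * (c • s) b) = c • (GR n M a *ᵥ fun b => gz n M M₀ z b * s b) := by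
  rw [← Matrix.mulVec_smul]
  congr 1
  funext b
  simp only [Pi.smul_apply, smul_eq_mul]
  ring

/-- linearity of `s ↦ G(h_z s)`: sums. [cite: Balaban1984PropagatorsI, (1.123) p.37] -/
theorem G_gz_add (z : Cen M M₀) (u v : VecR n M) :
    (GR n M a *ᵥ fun b => gz n M M₀ z b * (u + v) b)
      = (GR n M a *ᵥ fun b => gz n M M₀ z b * u b) + GR n M a *ᵥ fun b => gz n M M₀ z b * v b := by
  rw [← Matrix.mulVec_add]
  congr 1
  funext b
  simp only [Pi.add_apply]
  ring

end FirstAdj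

/-! ## §3 The last factor (1.129) for the adjoint sources, by Hölder duality -/

section LastAdj

variable {n : ℕ} [NeZero n] {M : Fin d → ℕ} [hM : ∀ μ, NeZero (M μ)] {a : ℝ} {M₀ : ℕ} (k : ℕ)
  {C : ℝ} {Cα Cε : ℝ → ℝ} {Cαε : ℝ → ℝ → ℝ}

/-- **duality for `ℓ¹` sums** (folklore): if `Σ_i s_i w_i ≤ B` for every `s` with `‖s‖_∞ ≤ 1`, then `Σ_i |w_i| ≤ B`.
[cite: Balaban1984PropagatorsI, p.39 L7–9 (adjoint representation), (1.108) p.35] -/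
theorem sum_abs_le_of_dual {ι : Type} [Fintype ι] (w : ι → ℝ) {B : ℝ}
    (h : ∀ s : ι → ℝ, ‖s‖ ≤ 1 → ∑ i, s i * w i ≤ B) : ∑ i, |w i| ≤ B := by
  have := h (fun i => ((SignType.sign (w i) : SignType) : ℝ)) (norm_sign_le_one w)
  simpa only [sign_mul_self] using this

/-- **LAST FACTOR, MONOPOLE**: `‖G(h_z(c·e_{b₀}))‖₁ ≤ C|c|` and `‖∇G(h_z(c·e_{b₀}))‖₁ ≤ C|c|` ((1.115) on `ℓ¹`, `‖h_ze_{b₀}‖₁ ≤ 1`).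
[cite: Balaban1984PropagatorsI, (1.129) p.38, (1.115) p.36, p.39 L7–9] -/
theorem last_mono_le (hn : 1 ≤ n) (ha : 0 < a) (hC : 0 ≤ C)
    (hG : B5.Global115_117 (latticeSettingP12R n M a k) (gP12R M n a k) C Cα Cε Cαε) (z : Cen M M₀) (b₀ : Bnd n M)
    (c : ℝ) :
    l1grad n M (GR n M a *ᵥ fun b => gz n M M₀ z b * (c * mono n M b₀ b))
      + l1 n M (GR n M a *ᵥ fun b => gz n M M₀ z b * (c * mono n M b₀ b)) ≤ 2 * C * |c| := by
  obtain ⟨h1, h2⟩ := l1_G_le k hn ha hC hG (fun b => gz n M M₀ z b * (c * mono n M b₀ b))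
  have hsrc : l1 n M (fun b => gz n M M₀ z b * (c * mono n M b₀ b)) ≤ |c| := by
    unfold l1
    calc ∑ b, |gz n M M₀ z b * (c * mono n M b₀ b)| ≤ ∑ b, |c * mono n M b₀ b| :=
          Finset.sum_le_sum fun b _ => by
            rw [abs_mul]
            have hg := abs_gz_le_one (n := n) z b
            have h0 := abs_nonneg (c * mono n M b₀ b)
            nlinarith
      _ ≤ |c| := sum_abs_smul_mono_le b₀ c
  nlinarith

/-- **pair estimate for the product with the (unshifted) multiplier `h_z`**: if `|F(x′,μ) − F(x,μ)| ≤ Q·t^α` then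
`|h_z(x′,μ)F(x′,μ) − h_z(x,μ)F(x,μ)| ≤ ((Lw/M₀)|F| + Q)·t^α` (`α ≤ 1`). [cite: Balaban1984PropagatorsI, (1.125) p.38, (1.121) p.37] -/
theorem pair_gz_le (hn : 1 ≤ n) (hM₀ : 1 ≤ M₀) (z : Cen M M₀) {α : ℝ} (hα : α ≤ 1) (F : VecR n M)
    {x x' : Tor (fine n M)} (μ : Fin d) {Q : ℝ} (h1 : distU n M x x' ≤ 1) (h0 : 0 < distU n M x x')
    (hQ : |F (x', μ) - F (x, μ)| ≤ Q * distU n M x x' ^ α) :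
    |gz n M M₀ z (x', μ) * F (x', μ) - gz n M M₀ z (x, μ) * F (x, μ)| ≤ (Lw d / M₀ * ‖F‖ + Q) * distU n M x x' ^ α := by
  have ht : 0 ≤ distU n M x x' ^ α := Real.rpow_nonneg h0.le α
  have htt : distU n M x x' ≤ distU n M x x' ^ α := le_rpow_self_of_le_one h0 h1 hα
  have hL : 0 ≤ Lw d / M₀ := div_nonneg (Lw_nonneg d) (Nat.cast_nonneg _)
  have hg : |gz n M M₀ z (x', μ) - gz n M M₀ z (x, μ)| ≤ Lw d / M₀ * distU n M x x' ^ α := by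
    refine (abs_gz_sub_le hn hM₀ z _ _).trans ?_
    rw [show ((x', μ) : Bnd n M).1 = x' from rfl, show ((x, μ) : Bnd n M).1 = x from rfl, distU_comm]
    exact mul_le_mul_of_nonneg_left htt hL
  have hg1 : |gz n M M₀ z (x, μ)| ≤ 1 := abs_gz_le_one (n := n) z _
  have hF : |F (x', μ)| ≤ ‖F‖ := abs_le_norm F _
  calc |gz n M M₀ z (x', μ) * F (x', μ) - gz n M M₀ z (x, μ) * F (x, μ)|
      ≤ |gz n M M₀ z (x', μ) - gz n M M₀ z (x, μ)| * |F (x', μ)| + |gz n M M₀ z (x, μ)| * |F (x', μ) - F (x, μ)| :=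
        abs_mul_sub_mul_le _ _ _ _
    _ ≤ (Lw d / M₀ * distU n M x x' ^ α) * ‖F‖ + 1 * (Q * distU n M x x' ^ α) :=
        add_le_add (mul_le_mul hg hF (abs_nonneg _) (mul_nonneg hL ht)) (mul_le_mul hg1 hQ (abs_nonneg _) zero_le_one)
    _ = (Lw d / M₀ * ‖F‖ + Q) * distU n M x x' ^ α := by ring

/-- **LAST FACTOR, DIPOLE, the `G` member**: `‖G(h_z(e_{(x′,μ)} − e_{(x,μ)}))‖₁ ≤ (Lw + d)·C·|x−x′|^α` for `0 < |x−x′| ≤ 1`, `α ≤ 1` —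
by duality from `|GB|, |∇GB| ≤ C|B|` and the lattice path («Hölder from gradient»).
[cite: Balaban1984PropagatorsI, (1.129) p.38, (1.115) p.36, Prop. 1.1 p.33, p.39 L7–9] -/
theorem l1_G_gz_dip_le (hn : 1 ≤ n) (ha : 0 < a) (hM₀ : 1 ≤ M₀) (hC : 0 ≤ C)
    (hG : B5.Global115_117 (latticeSettingP12R n M a k) (gP12R M n a k) C Cα Cε Cαε) (z : Cen M M₀)
    {α : ℝ} (hα : α ≤ 1) {x x' : Tor (fine n M)} (μ : Fin d) (h1 : distU n M x x' ≤ 1) (h0 : 0 < distU n M x x') :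
    l1 n M (GR n M a *ᵥ fun b => gz n M M₀ z b * dip n M (x, μ) (x', μ) b) ≤ (Lw d + d) * C * distU n M x x' ^ α := by
  unfold l1
  refine sum_abs_le_of_dual _ fun s hs => ?_
  have ht : 0 ≤ distU n M x x' ^ α := Real.rpow_nonneg h0.le α
  -- move `G` and `h_z` to the test vector: `Σ s·G(h·dip) = Σ dip·(h·Gs) = (hGs)(x′,μ) − (hGs)(x,μ)`
  rw [← sum_G_mul_eq hn ha]
  have e : ∑ b, (GR n M a *ᵥ s) b * (gz n M M₀ z b * dip n M (x, μ) (x', μ) b)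
      = ∑ b, dip n M (x, μ) (x', μ) b * (gz n M M₀ z b * (GR n M a *ᵥ s) b) := Finset.sum_congr rfl fun b _ => by ring
  rw [e, sum_dip_mul]
  set F : VecR n M := GR n M a *ᵥ s with hF
  have hFn : ‖F‖ ≤ C * ‖s‖ := norm_G_le k hn hC hG s
  have hgF : ‖gradR n M F‖ ≤ C * ‖s‖ := norm_gradR_G_le k hn hC hG s
  have hQ := pair_grad_le hα F μ h1 h0
  have hp := pair_gz_le hn hM₀ z hα F μ h1 h0 hQ
  refine (le_abs_self _).trans (hp.trans (mul_le_mul_of_nonneg_right ?_ ht))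
  have h3 := Lw_div_le (d := d) hM₀
  have hd : (0 : ℝ) ≤ d := Nat.cast_nonneg d
  have hLw := Lw_nonneg d
  have e1 : Lw d / M₀ * ‖F‖ ≤ Lw d * (C * 1) := by
    have : ‖F‖ ≤ C * 1 := hFn.trans (mul_le_mul_of_nonneg_left hs hC)
    exact mul_le_mul h3 this (norm_nonneg _) hLw
  have e2 : d * ‖gradR n M F‖ ≤ d * (C * 1) := mul_le_mul_of_nonneg_left (hgF.trans (mul_le_mul_of_nonneg_left hs hC)) hd
  linarith

/-- **LAST FACTOR, DIPOLE, the `∇G` member**: `‖∇G(h_z(e_{(x′,μ)} − e_{(x,μ)}))‖₁ ≤ (Lw·C + |C_α(α)|)·|x−x′|^α`, `0 ≤ α < 1` — by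
duality from `|G∇*T| ≤ C|T|`, `‖G∇*T‖_α ≤ C_α(α)|T|` ((1.115), `G` symmetric). [cite: Balaban1984PropagatorsI, (1.129) p.38, (1.115) p.36, Prop. 1.1 p.33, p.39 L7–9] -/
theorem l1grad_G_gz_dip_le (hn : 1 ≤ n) (ha : 0 < a) (hM₀ : 1 ≤ M₀) (hC : 0 ≤ C)
    (hG : B5.Global115_117 (latticeSettingP12R n M a k) (gP12R M n a k) C Cα Cε Cαε) (z : Cen M M₀)
    {α : ℝ} (hα0 : 0 ≤ α) (hα1 : α < 1) {x x' : Tor (fine n M)} (μ : Fin d) (h1 : distU n M x x' ≤ 1)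
    (h0 : 0 < distU n M x x') :
    l1grad n M (GR n M a *ᵥ fun b => gz n M M₀ z b * dip n M (x, μ) (x', μ) b)
      ≤ (Lw d * C + |Cα α|) * distU n M x x' ^ α := by
  unfold l1grad
  rw [← Fintype.sum_prod_type']
  refine sum_abs_le_of_dual _ fun s hs => ?_
  have ht : 0 ≤ distU n M x x' ^ α := Real.rpow_nonneg h0.le α
  -- `Σ_{ν,b} s(ν,b)(∇_ν G(h·dip))(b) = pair S (G(h·dip)) = Σ_c (h·dip)(c)(G∇*S)(c)`, `S = curry s`
  set S : Fin d → VecR n M := fun ν b => s (ν, b) with hS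
  have e1 : ∑ q : Fin d × Bnd n M, s q * gradR n M (GR n M a *ᵥ fun b => gz n M M₀ z b * dip n M (x, μ) (x', μ) b) q.1 q.2
      = pair n M S (GR n M a *ᵥ fun b => gz n M M₀ z b * dip n M (x, μ) (x', μ) b) := by
    rw [pair, Fintype.sum_prod_type]
    exact Finset.sum_congr rfl fun ν _ => Finset.sum_congr rfl fun b _ => by rw [hS]; ring
  rw [e1, pair_G_eq hn ha]
  have e2 : ∑ b, gz n M M₀ z b * dip n M (x, μ) (x', μ) b * (GR n M a *ᵥ divTR n M S) b
      = ∑ b, dip n M (x, μ) (x', μ) b * (gz n M M₀ z b * (GR n M a *ᵥ divTR n M S) b) :=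
    Finset.sum_congr rfl fun b _ => by ring
  rw [e2, sum_dip_mul]
  set F : VecR n M := GR n M a *ᵥ divTR n M S with hF
  have hSn : ‖S‖ ≤ 1 := by
    refine (pi_norm_le_iff_of_nonneg zero_le_one).mpr fun ν => (pi_norm_le_iff_of_nonneg zero_le_one).mpr fun b => ?_
    exact (norm_le_pi_norm s (ν, b)).trans hs
  have hFn : ‖F‖ ≤ C * ‖S‖ := by
    have h := B5SupCarrierTorus.norm_Gs_divTR_le_of_global k hn hC hG S
    rwa [Gs_apply] at h
  have hQ : |F (x', μ) - F (x, μ)| ≤ |Cα α| * ‖S‖ * distU n M x x' ^ α := by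
    refine (abs_sub_le_holderV_mul α F μ h1 h0).trans (mul_le_mul_of_nonneg_right ?_ ht)
    exact (holderV_G_divTR_le_of_global k hG hα0 hα1 S).trans (mul_le_mul_of_nonneg_right (le_abs_self _) (norm_nonneg S))
  have hp := pair_gz_le hn hM₀ z hα1.le F μ h1 h0 hQ
  refine (le_abs_self _).trans (hp.trans (mul_le_mul_of_nonneg_right ?_ ht))
  have h3 := Lw_div_le (d := d) hM₀
  have hLw := Lw_nonneg d
  have hCa := abs_nonneg (Cα α)
  have e3 : Lw d / M₀ * ‖F‖ ≤ Lw d * (C * 1) := by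
    have : ‖F‖ ≤ C * 1 := hFn.trans (mul_le_mul_of_nonneg_left hSn hC)
    exact mul_le_mul h3 this (norm_nonneg _) hLw
  have e4 : |Cα α| * ‖S‖ ≤ |Cα α| * 1 := mul_le_mul_of_nonneg_left hSn hCa
  linarith

/-- **the source of the adjoint Hölder problem**: `ζ(x′)e_{(x′,μ)} − ζ(x)e_{(x,μ)}` — the numerator of the Hölder quotient of `ζW`
at the pair is `⟨cutSrc, W⟩`. [cite: Balaban1984PropagatorsI, (1.111) p.35, p.39 L7–9] -/
def cutSrc (n : ℕ) (M : Fin d → ℕ) (ζ : Tor (fine n M) → ℝ) (μ : Fin d) (x x' : Tor (fine n M)) : VecR n M :=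
  fun c => ζ x' * mono n M (x', μ) c - ζ x * mono n M (x, μ) c

omit [NeZero n] hM in
/-- the dipole decomposition `ζ(x′)e_{x′} − ζ(x)e_x = ζ(x′)(e_{x′} − e_x) + (ζ(x′) − ζ(x))e_x`. [cite: Balaban1984PropagatorsI, (1.111) p.35, p.39 L7–9] -/
theorem cutSrc_eq (ζ : Tor (fine n M) → ℝ) (μ : Fin d) (x x' : Tor (fine n M)) :
    cutSrc n M ζ μ x x' = ζ x' • dip n M (x, μ) (x', μ) + (ζ x' - ζ x) • mono n M (x, μ) := by
  funext c
  simp only [cutSrc, dip, mono, Pi.add_apply, Pi.smul_apply, Pi.sub_apply, smul_eq_mul]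
  ring

/-- `⟨cutSrc, w⟩ = ζ(x′)w(x′,μ) − ζ(x)w(x,μ)`. [cite: Balaban1984PropagatorsI, (1.111) p.35, p.39 L7–9] -/
theorem sum_cutSrc_mul (ζ : Tor (fine n M) → ℝ) (μ : Fin d) (x x' : Tor (fine n M)) (w : VecR n M) :
    ∑ c, cutSrc n M ζ μ x x' c * w c = ζ x' * w (x', μ) - ζ x * w (x, μ) := by
  simp only [cutSrc, sub_mul, Finset.sum_sub_distrib, mul_assoc, ← Finset.mul_sum, sum_mono_mul]

omit [NeZero n] hM in
/-- the source of the adjoint Hölder problem lives where `ζ` does: `cutSrc(c) ≠ 0 ⇒ ζ(c.1) ≠ 0`.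
[cite: Balaban1984PropagatorsI, (1.111) p.35 («ζ ∈ C₀^∞(Δ̃(y))»)] -/
theorem cut_ne_zero_of_cutSrc_ne_zero {ζ : Tor (fine n M) → ℝ} {μ : Fin d} {x x' : Tor (fine n M)} {c : Bnd n M}
    (h : cutSrc n M ζ μ x x' c ≠ 0) : ζ c.1 ≠ 0 := by
  intro h0
  apply h
  unfold cutSrc mono
  rw [Pi.single_apply, Pi.single_apply]
  by_cases h1 : c = (x', μ)
  · by_cases h2 : c = (x, μ)
    · have hx : x' = x := by have := h1.symm.trans h2; exact (Prod.mk.inj this).1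
      rw [if_pos h1, if_pos h2, hx]; ring
    · rw [if_pos h1, if_neg h2]
      have : ζ x' = 0 := by rw [h1] at h0; exact h0
      rw [this]; ring
  · by_cases h2 : c = (x, μ)
    · rw [if_neg h1, if_pos h2]
      have : ζ x = 0 := by rw [h2] at h0; exact h0
      rw [this]; ring
    · rw [if_neg h1, if_neg h2]; ring

/-- the constant of the adjoint last factor: `2Lw + d + 2`. [cite: Balaban1984PropagatorsI, (1.129) p.38] -/
def cLA (d : ℕ) : ℝ := 2 * Lw d + d + 2

omit hM in
/-- `2 ≤ cLA`. [cite: Balaban1984PropagatorsI, (1.129) p.38] -/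
theorem two_le_cLA : 2 ≤ cLA d := by
  unfold cLA; have := Lw_nonneg d; have : (0 : ℝ) ≤ d := Nat.cast_nonneg d; linarith

/-- **LAST FACTOR OF THE ADJOINT HÖLDER PROBLEM**: `‖∇G(h_z·cutSrc)‖₁ + ‖G(h_z·cutSrc)‖₁ ≤ cLA·(C + |C_α(α)|)·(‖ζ‖_α + |ζ|)·|x−x′|^α`
(dipole + monopole decomposition, `|ζ(x′) − ζ(x)| ≤ ‖ζ‖_α|x−x′|^α`). [cite: Balaban1984PropagatorsI, (1.129) p.38, (1.111) p.35, p.39 L7–9] -/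
theorem size_cutSrc_le (hn : 1 ≤ n) (ha : 0 < a) (hM₀ : 1 ≤ M₀) (hC : 0 ≤ C)
    (hG : B5.Global115_117 (latticeSettingP12R n M a k) (gP12R M n a k) C Cα Cε Cαε) (z : Cen M M₀)
    {α : ℝ} (hα0 : 0 ≤ α) (hα1 : α < 1) (ζ : Tor (fine n M) → ℝ) (μ : Fin d) {x x' : Tor (fine n M)}
    (h1 : distU n M x x' ≤ 1) (h0 : 0 < distU n M x x') :
    l1grad n M (GR n M a *ᵥ fun b => gz n M M₀ z b * cutSrc n M ζ μ x x' b)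
      + l1 n M (GR n M a *ᵥ fun b => gz n M M₀ z b * cutSrc n M ζ μ x x' b)
      ≤ cLA d * (C + |Cα α|) * (B5SupHolderTorus.holS n M α ζ + cutSupL n M ζ) * distU n M x x' ^ α := by
  have ht : 0 ≤ distU n M x x' ^ α := Real.rpow_nonneg h0.le α
  rw [cutSrc_eq, G_gz_add, G_gz_smul, G_gz_smul]
  set Wd : VecR n M := GR n M a *ᵥ fun b => gz n M M₀ z b * dip n M (x, μ) (x', μ) b
  set Wm : VecR n M := GR n M a *ᵥ fun b => gz n M M₀ z b * mono n M (x, μ) b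
  have hd1 := l1_G_gz_dip_le k hn ha hM₀ hC hG z hα1.le μ h1 h0
  have hd2 := l1grad_G_gz_dip_le k hn ha hM₀ hC hG z hα0 hα1 μ h1 h0
  have hm : l1grad n M Wm + l1 n M Wm ≤ 2 * C := by
    have h := last_mono_le k hn ha hC hG z (x, μ) 1
    simp only [one_mul, abs_one, mul_one] at h
    exact h
  have hζ : |ζ x'| ≤ cutSupL n M ζ := B5SupHolderTorus.abs_le_cutSupL ζ x'
  have hdζ : |ζ x' - ζ x| ≤ B5SupHolderTorus.holS n M α ζ * distU n M x x' ^ α :=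
    B5SupHolderTorus.abs_sub_le_holS_mul α ζ h1 h0
  have hS := B5SupHolderTorus.holS_nonneg (n := n) (M := M) α ζ
  have hZ := B5SupHolderTorus.cutSupL_nonneg' (n := n) (M := M) ζ
  have hCa := abs_nonneg (Cα α)
  have hLw := Lw_nonneg d
  have hd : (0 : ℝ) ≤ d := Nat.cast_nonneg d
  calc l1grad n M (ζ x' • Wd + (ζ x' - ζ x) • Wm) + l1 n M (ζ x' • Wd + (ζ x' - ζ x) • Wm)
      ≤ (l1grad n M (ζ x' • Wd) + l1grad n M ((ζ x' - ζ x) • Wm)) + (l1 n M (ζ x' • Wd) + l1 n M ((ζ x' - ζ x) • Wm)) :=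
        add_le_add (l1grad_add_le _ _) (l1_add_le _ _)
    _ = |ζ x'| * (l1grad n M Wd + l1 n M Wd) + |ζ x' - ζ x| * (l1grad n M Wm + l1 n M Wm) := by
        rw [l1grad_smul, l1grad_smul, l1_smul, l1_smul]; ring
    _ ≤ cutSupL n M ζ * ((Lw d * C + |Cα α|) * distU n M x x' ^ α + (Lw d + d) * C * distU n M x x' ^ α)
        + B5SupHolderTorus.holS n M α ζ * distU n M x x' ^ α * (2 * C) :=
        add_le_add (mul_le_mul hζ (add_le_add hd2 hd1) (add_nonneg (l1grad_nonneg _) (l1_nonneg _)) hZ)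
          (mul_le_mul hdζ hm (add_nonneg (l1grad_nonneg _) (l1_nonneg _)) (mul_nonneg hS ht))
    _ ≤ cLA d * (C + |Cα α|) * (B5SupHolderTorus.holS n M α ζ + cutSupL n M ζ) * distU n M x x' ^ α := by
        unfold cLA
        have e1 : cutSupL n M ζ * ((Lw d * C + |Cα α|) + (Lw d + d) * C)
            ≤ cutSupL n M ζ * ((2 * Lw d + d + 2) * (C + |Cα α|)) :=
          mul_le_mul_of_nonneg_left (by nlinarith) hZ
        have e2 : B5SupHolderTorus.holS n M α ζ * (2 * C) ≤ B5SupHolderTorus.holS n M α ζ * ((2 * Lw d + d + 2) * (C + |Cα α|)) :=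
          mul_le_mul_of_nonneg_left (by nlinarith) hS
        nlinarith

end LastAdj

/-! ## §4 The one-factor terms (1.130) of the adjoint problems -/

section OneAdj

variable {n : ℕ} [NeZero n] {M : Fin d → ℕ} [hM : ∀ μ, NeZero (M μ)] {a : ℝ} {M₀ : ℕ} (k : ℕ)
  {C : ℝ} {Cα Cε : ℝ → ℝ} {Cαε : ℝ → ℝ → ℝ}

/-- **ONE-FACTOR, MONOPOLE**: `|(h_zGh_z∇*T)(b₀)| ≤ (1 + dLw)·C·|T|`. [cite: Balaban1984PropagatorsI, (1.130) p.38, (1.115) p.36, p.39 L7–9] -/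
theorem abs_gz_G_gz_divTR_le (hn : 1 ≤ n) (hM₀ : 1 ≤ M₀) (hC : 0 ≤ C)
    (hG : B5.Global115_117 (latticeSettingP12R n M a k) (gP12R M n a k) C Cα Cε Cαε) (z : Cen M M₀)
    (T : Fin d → VecR n M) (b₀ : Bnd n M) :
    |gz n M M₀ z b₀ * (GR n M a *ᵥ fun b' => gz n M M₀ z b' * divTR n M T b') b₀| ≤ (1 + d * Lw d) * C * ‖T‖ := by
  have h := (abs_le_norm _ b₀).trans (norm_G_gz_divTR_le k hn hM₀ hC hG z T)
  rw [abs_mul]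
  have hg := abs_gz_le_one (n := n) z b₀
  have h0 := abs_nonneg ((GR n M a *ᵥ fun b' => gz n M M₀ z b' * divTR n M T b') b₀)
  nlinarith

/-- the constant of the adjoint one-factor Hölder term: `(Lw + d²Lw)(1 + dLw) + (1 + Lw)`. [cite: Balaban1984PropagatorsI, (1.130) p.38] -/
def c1A (d : ℕ) : ℝ := (Lw d + d * d * Lw d) * (1 + d * Lw d) + (1 + Lw d)

omit hM in
/-- `0 ≤ c1A`. [cite: Balaban1984PropagatorsI, (1.130) p.38] -/
theorem c1A_nonneg : 0 ≤ c1A d := by unfold c1A; have := Lw_nonneg d; positivity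

/-- **ONE-FACTOR, DIPOLE (the Hölder quotient of `h_z·G(h_z∇*T)` at a pair)**: for `0 ≤ α < 1` and `0 < |x−x′| ≤ 1`,
`|h_z(x′,μ)(Gh_z∇*T)(x′,μ) − h_z(x,μ)(Gh_z∇*T)(x,μ)| ≤ c1A·(C + |C_α(α)|)·|T|·|x−x′|^α` — from `|Gh_z∇*T| ≤ (1 + dLw)C|T|` (FILE C),
`‖G∇*(h_zT)‖_α ≤ C_α(α)|h_zT|` and `|∇G E_zT| ≤ C·dLw|T|` (lattice path). [cite: Balaban1984PropagatorsI, (1.130) p.38, (1.115) p.36, p.39 L7–9] -/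
theorem quot_gz_G_gz_divTR_le (hn : 1 ≤ n) (hM₀ : 1 ≤ M₀) (hC : 0 ≤ C)
    (hG : B5.Global115_117 (latticeSettingP12R n M a k) (gP12R M n a k) C Cα Cε Cαε) (z : Cen M M₀)
    (T : Fin d → VecR n M) {α : ℝ} (hα0 : 0 ≤ α) (hα1 : α < 1) {x x' : Tor (fine n M)} (μ : Fin d)
    (h1 : distU n M x x' ≤ 1) (h0 : 0 < distU n M x x') :
    |gz n M M₀ z (x', μ) * (GR n M a *ᵥ fun b' => gz n M M₀ z b' * divTR n M T b') (x', μ)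
        - gz n M M₀ z (x, μ) * (GR n M a *ᵥ fun b' => gz n M M₀ z b' * divTR n M T b') (x, μ)|
      ≤ c1A d * (C + |Cα α|) * ‖T‖ * distU n M x x' ^ α := by
  have ht : 0 ≤ distU n M x x' ^ α := Real.rpow_nonneg h0.le α
  have hT0 := norm_nonneg T
  have hCa := abs_nonneg (Cα α)
  have hLw := Lw_nonneg d
  have hd : (0 : ℝ) ≤ d := Nat.cast_nonneg d
  have h3 := Lw_div_le (d := d) hM₀
  set W : VecR n M := GR n M a *ᵥ fun b' => gz n M M₀ z b' * divTR n M T b' with hW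
  -- `W = G∇*(h_zT) + G E_zT`; the Hölder datum of `W` at the pair
  have hsplit : W = GR n M a *ᵥ divTR n M (fun ν b => gz n M M₀ z b * T ν b) + GR n M a *ᵥ B5WalkLeibnizTorus.Ediv (gz n M M₀ z) T := by
    rw [hW, gz_divTR_eq, Matrix.mulVec_add]
  have hQ : |W (x', μ) - W (x, μ)| ≤ (|Cα α| * ‖T‖ + d * (C * (d * Lw d * ‖T‖))) * distU n M x x' ^ α := by
    rw [hsplit]
    simp only [Pi.add_apply]
    have hA := abs_sub_le_holderV_mul α (GR n M a *ᵥ divTR n M fun ν b => gz n M M₀ z b * T ν b) μ h1 h0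
    have hA' : holderV n M α (cplx (GR n M a *ᵥ divTR n M fun ν b => gz n M M₀ z b * T ν b)) ≤ |Cα α| * ‖T‖ := by
      refine (holderV_G_divTR_le_of_global k hG hα0 hα1 _).trans ?_
      have hb := B5SupFactor125Torus.norm_gz_mul_ten_le z T
      calc Cα α * _ ≤ |Cα α| * _ := mul_le_mul_of_nonneg_right (le_abs_self _) (norm_nonneg _)
        _ ≤ |Cα α| * ‖T‖ := mul_le_mul_of_nonneg_left hb hCa
    have hB := pair_grad_le hα1.le (GR n M a *ᵥ B5WalkLeibnizTorus.Ediv (gz n M M₀ z) T) μ h1 h0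
    have hB' : ‖gradR n M (GR n M a *ᵥ B5WalkLeibnizTorus.Ediv (gz n M M₀ z) T)‖ ≤ C * (d * Lw d * ‖T‖) := by
      refine (norm_gradR_G_le k hn hC hG _).trans (mul_le_mul_of_nonneg_left ?_ hC)
      refine (B5SupHolderTorus.norm_Ediv_le hn hM₀ z T).trans ?_
      exact mul_le_mul_of_nonneg_right (mul_le_mul_of_nonneg_left h3 hd) hT0
    calc |(GR n M a *ᵥ divTR n M fun ν b => gz n M M₀ z b * T ν b) (x', μ) + (GR n M a *ᵥ B5WalkLeibnizTorus.Ediv (gz n M M₀ z) T) (x', μ)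
          - ((GR n M a *ᵥ divTR n M fun ν b => gz n M M₀ z b * T ν b) (x, μ) + (GR n M a *ᵥ B5WalkLeibnizTorus.Ediv (gz n M M₀ z) T) (x, μ))|
        = |((GR n M a *ᵥ divTR n M fun ν b => gz n M M₀ z b * T ν b) (x', μ) - (GR n M a *ᵥ divTR n M fun ν b => gz n M M₀ z b * T ν b) (x, μ))
          + ((GR n M a *ᵥ B5WalkLeibnizTorus.Ediv (gz n M M₀ z) T) (x', μ) - (GR n M a *ᵥ B5WalkLeibnizTorus.Ediv (gz n M M₀ z) T) (x, μ))| := by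
          ring_nf
      _ ≤ _ := abs_add_le _ _
      _ ≤ holderV n M α (cplx (GR n M a *ᵥ divTR n M fun ν b => gz n M M₀ z b * T ν b)) * distU n M x x' ^ α
          + d * ‖gradR n M (GR n M a *ᵥ B5WalkLeibnizTorus.Ediv (gz n M M₀ z) T)‖ * distU n M x x' ^ α := add_le_add hA hB
      _ ≤ |Cα α| * ‖T‖ * distU n M x x' ^ α + d * (C * (d * Lw d * ‖T‖)) * distU n M x x' ^ α :=
          add_le_add (mul_le_mul_of_nonneg_right hA' ht)
            (mul_le_mul_of_nonneg_right (mul_le_mul_of_nonneg_left hB' hd) ht)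
      _ = _ := by ring
  have hp := pair_gz_le hn hM₀ z hα1.le W μ h1 h0 hQ
  refine hp.trans (mul_le_mul_of_nonneg_right ?_ ht)
  have hWn : ‖W‖ ≤ (1 + d * Lw d) * C * ‖T‖ := norm_G_gz_divTR_le k hn hM₀ hC hG z T
  have e1 : Lw d / M₀ * ‖W‖ ≤ Lw d * ((1 + d * Lw d) * C * ‖T‖) := mul_le_mul h3 hWn (norm_nonneg _) hLw
  have hX : 0 ≤ C * ‖T‖ := mul_nonneg hC hT0
  have hY : 0 ≤ |Cα α| * ‖T‖ := mul_nonneg hCa hT0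
  have hDL : 0 ≤ (d : ℝ) * Lw d := mul_nonneg hd hLw
  have t1 : 0 ≤ (d : ℝ) * d * Lw d * (d * Lw d) := mul_nonneg (mul_nonneg (mul_nonneg hd hd) hLw) hDL
  have t2 : 0 ≤ (Lw d + d * d * Lw d) * (1 + d * Lw d) :=
    mul_nonneg (add_nonneg hLw (mul_nonneg (mul_nonneg hd hd) hLw)) (by linarith)
  calc Lw d / M₀ * ‖W‖ + (|Cα α| * ‖T‖ + d * (C * (d * Lw d * ‖T‖)))
      ≤ Lw d * ((1 + d * Lw d) * C * ‖T‖) + (|Cα α| * ‖T‖ + d * (C * (d * Lw d * ‖T‖))) := by linarith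
    _ = (Lw d * (1 + d * Lw d) + d * (d * Lw d)) * (C * ‖T‖) + 1 * (|Cα α| * ‖T‖) := by ring
    _ ≤ c1A d * (C * ‖T‖) + c1A d * (|Cα α| * ‖T‖) := by
        unfold c1A
        refine add_le_add (mul_le_mul_of_nonneg_right ?_ hX) (mul_le_mul_of_nonneg_right ?_ hY)
        · nlinarith [t1]
        · nlinarith [t2]
    _ = c1A d * (C + |Cα α|) * ‖T‖ := by ring

/-- **ONE-FACTOR TERM OF THE ADJOINT HÖLDER PROBLEM**: with `U = h_z·G(h_z∇*T)`,
`|ζ(x′)U(x′,μ) − ζ(x)U(x,μ)| ≤ (c1A + 1 + dLw)·(C + |C_α(α)|)·(‖ζ‖_α + |ζ|)·|T|·|x−x′|^α`.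
[cite: Balaban1984PropagatorsI, (1.130) p.38, (1.111) p.35, p.39 L7–9] -/
theorem one_cutSrc_le (hn : 1 ≤ n) (hM₀ : 1 ≤ M₀) (hC : 0 ≤ C)
    (hG : B5.Global115_117 (latticeSettingP12R n M a k) (gP12R M n a k) C Cα Cε Cαε) (z : Cen M M₀)
    (T : Fin d → VecR n M) {α : ℝ} (hα0 : 0 ≤ α) (hα1 : α < 1) (ζ : Tor (fine n M) → ℝ) (μ : Fin d)
    {x x' : Tor (fine n M)} (h1 : distU n M x x' ≤ 1) (h0 : 0 < distU n M x x') :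
    |ζ x' * (gz n M M₀ z (x', μ) * (GR n M a *ᵥ fun b' => gz n M M₀ z b' * divTR n M T b') (x', μ))
        - ζ x * (gz n M M₀ z (x, μ) * (GR n M a *ᵥ fun b' => gz n M M₀ z b' * divTR n M T b') (x, μ))|
      ≤ (c1A d + 1 + d * Lw d) * (C + |Cα α|) * (B5SupHolderTorus.holS n M α ζ + cutSupL n M ζ) * ‖T‖
        * distU n M x x' ^ α := by
  have ht : 0 ≤ distU n M x x' ^ α := Real.rpow_nonneg h0.le α
  set U : VecR n M := fun b => gz n M M₀ z b * (GR n M a *ᵥ fun b' => gz n M M₀ z b' * divTR n M T b') b with hU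
  have hQ := quot_gz_G_gz_divTR_le k hn hM₀ hC hG z T hα0 hα1 μ h1 h0
  have hp := B5SupFactor125Torus.pair_cut_le α ζ U μ h1 h0 hQ
  refine hp.trans (mul_le_mul_of_nonneg_right ?_ ht)
  have hUn : ‖U‖ ≤ (1 + d * Lw d) * C * ‖T‖ :=
    (norm_gz_mul_le z _).trans (norm_G_gz_divTR_le k hn hM₀ hC hG z T)
  have hS := B5SupHolderTorus.holS_nonneg (n := n) (M := M) α ζ
  have hZ := B5SupHolderTorus.cutSupL_nonneg' (n := n) (M := M) ζ
  have hCa := abs_nonneg (Cα α)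
  have hT := norm_nonneg T
  have hLw := Lw_nonneg d
  have hd : (0 : ℝ) ≤ d := Nat.cast_nonneg d
  have hA := c1A_nonneg (d := d)
  have e1 : B5SupHolderTorus.holS n M α ζ * ‖U‖
      ≤ B5SupHolderTorus.holS n M α ζ * ((c1A d + 1 + d * Lw d) * (C + |Cα α|) * ‖T‖) := by
    refine mul_le_mul_of_nonneg_left (hUn.trans ?_) hS
    have : (1 + d * Lw d) * C ≤ (c1A d + 1 + d * Lw d) * (C + |Cα α|) := by
      have hDL : 0 ≤ (d : ℝ) * Lw d := mul_nonneg hd hLw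
      have u1 : (1 + d * Lw d) * C ≤ (1 + d * Lw d) * (C + |Cα α|) :=
        mul_le_mul_of_nonneg_left (by linarith) (by linarith)
      have u2 : (1 + d * Lw d) * (C + |Cα α|) ≤ (c1A d + 1 + d * Lw d) * (C + |Cα α|) :=
        mul_le_mul_of_nonneg_right (by linarith) (by linarith)
      linarith
    exact mul_le_mul_of_nonneg_right this hT
  have e2 : cutSupL n M ζ * (c1A d * (C + |Cα α|) * ‖T‖)
      ≤ cutSupL n M ζ * ((c1A d + 1 + d * Lw d) * (C + |Cα α|) * ‖T‖) := by
    refine mul_le_mul_of_nonneg_left (mul_le_mul_of_nonneg_right ?_ hT) hZ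
    have hDL : 0 ≤ (d : ℝ) * Lw d := mul_nonneg hd hLw
    exact mul_le_mul_of_nonneg_right (by linarith) (by linarith)
  linarith

end OneAdj

end

end Literature.MathematicalPhysics.QuantumFieldTheory.Balaban1983to89.B5SupFactor129AdjTorus
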